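import Summits.BirchSwinnertonDyer.BirchSwinnertonDyer.Theorems.AdditiveBranchIMCGordTwoTwistedLogTransportLoose
import Summits.BirchSwinnertonDyer.BirchSwinnertonDyer.Theorems.AdditiveBranchIMCGordTwoTwistedWanTwoDefs
import HarnessLib

/-!
# Route `AdditiveBranchIMC`, crux `GordTwoRankZeroOffCaseOne` (19357), line `three_field_road`, DOOR D («`ℓ₀ = 2` as the `K`-ramified twisted Wan
# prime», LeadReport27 §5 item 5): THE LOGARITHM TRANSPORT on the DYADIC twisted road (LEAD g19; `--supports` 19357, helper only)

Theorems only (no definition, no named fact, no `sorry`). The `ℓ₀ = 2` sibling of `logTransport_twisted_loose`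
(`AdditiveBranchIMCGordTwoTwistedLogTransportLoose.lean`, LEAD g18; itself `logTransport_twisted`, g16 p808640): the field hypothesis is
`TameRoadFieldTwistedTwo W p t K` (p819191) and the twist is `W₁ = C • E^{(t)}`, `t ∈ {−1, 2, −2}` — a `p`-UNIT for the odd `p`, which is the only
property of the twist parameter the transport uses (`norm_Δ_baseChange_eq_of_twist`: `‖Δ_E‖_p = ‖Δ_{W₁}‖_p`). Everything else verbatim.
* `logTransport_twisted_two`.
References: [SilvermanAEC2009] III.1 Table 3.1, Thm. IV.6.4, Prop. VII.2.2, X.5 Cor. 5.4; [CastellaHsieh2018] §3.3; [LiuZhangZhang2018] (1.5).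
presearch: n/a (kernel port). BSD is proved for no curve.
-/


noncomputable section

open scoped Classical NNReal

open WeierstrassCurve NumberField IsDedekindDomain Field
  Literature.NumberTheory.EllipticCurves
  Literature.NumberTheory.EllipticCurves.FormalGroupChart
  Literature.NumberTheory.EllipticCurves.LiuZhangZhang2018
  Summit.BirchSwinnertonDyer.Rank1Residual
  Summit.BirchSwinnertonDyer.Rank1Residual.X11b
  Summit.BirchSwinnertonDyer.Rank1Residual.X11b.Halves
  Summit.BirchSwinnertonDyer.BirchSwinnertonDyer.Theorems.SchneiderFree
  Summit.BirchSwinnertonDyer.BirchSwinnertonDyer.Theorems.SchneiderFree.KYRead.LogDescent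

set_option linter.dupNamespace false
set_option autoImplicit false

namespace Summit.BirchSwinnertonDyer.BirchSwinnertonDyer.Theorems.TwistedWanRoad

/-! ## §1 The twist descent of the logarithm, with `‖Δ_W‖ = ‖Δ_{W′}‖` in place of `p ∤ Δ_{W′}` -/


section Transport

/-- ★ **THE LOGARITHM TRANSPORT ON THE DYADIC TWISTED ROAD** (the `ℓ₀ = 2` sibling of `logTransport_twisted_loose`). For a dyadic twisted
road field `K` at the twist `t` (`TameRoadFieldTwistedTwo W p t K`: `K` imaginary quadratic, `p` split, `t ∈ {−1, 2, −2}`), `p ≠ 2`, the globally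
minimal `W₁` with `C • E^{(t)} = W₁`, an infinite place `w₀`, ANY `y ∈ W₁(H_K)`, a square root `θ ∈ H_K` of `t` with sign cocycle `s` and the
character `ν = s` of `Gal(H_K/K)`: the Galois descent `Q ∈ E(K)` of `Φ(Σ_τ s(τ)τy)` along the twist isomorphism (presentation
`E = C₂ • ((D • W₁) ⊗ χ_t)`; descent and height clause `[H_K:K]⁻¹ ĥ(Σ s(τ)τy) = ĥ(Q)` by `SchneiderFree.exists_descent_twistedHeegner`) satisfies,
for every datum `ι′ : ℚ̄_p ≃ ℂ` and degree-one `𝔭′ ∋ p` induced by `ι′`: `heegnerCharLogSum ι′ w₀.embedding 1 W₁ ν y = λ · log_{ω_E}(Q)_{embAt K p 𝔭′}`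
with `‖λ‖ = 1` (the twist descent of the logarithm with `‖Δ_E‖_p = ‖Δ_{W₁}‖_p`: `t` is a `p`-unit, `p` odd).
[cite: SilvermanAEC2009, III.1 Table 3.1, Thm. IV.6.4 with Prop. VII.2.2, X.5 Cor. 5.4]
[cite: CastellaHsieh2018, §3.3 (arXiv:1505.08165 p. 9)] [cite: LiuZhangZhang2018, (1.5) (Duke 167 pp. 746–747)] -/
theorem logTransport_twisted_two :
    ∀ (W : WeierstrassCurve ℚ) [W.IsElliptic] [W.IsGloballyMinimal] (p : ℕ) [Fact p.Prime] (t : ℤ)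
    (K : Type) [Field K] [NumberField K], TameRoadFieldTwistedTwo W p t K → p ≠ 2 →
    ∀ (W₁ : WeierstrassCurve ℚ) [W₁.IsElliptic] [W₁.IsGloballyMinimal]
    [(W₁.baseChange ℂ_[p]).IsIntegral (NormedField.valuation (K := ℂ_[p])).integer]
    (C : VariableChange ℚ), C • W.quadraticTwist (t : ℚ) = W₁ →
    ∀ (w₀ : InfinitePlace K) [NumberField (ringClassField K w₀.embedding 1)]
    (y : (W₁.baseChange (ringClassField K w₀.embedding 1)).toAffine.Point)
    (θ : ringClassField K w₀.embedding 1),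
    θ ^ 2 = ((t : ℤ) : ringClassField K w₀.embedding 1) → θ ≠ 0 →
    ∀ (s : ringClassGal w₀.embedding 1 → ℤˣ),
    (∀ σ : ringClassGal w₀.embedding 1, σ.1 θ = ((s σ : ℤ) : ringClassField K w₀.embedding 1) * θ) →
    ∀ (ν : ringClassGal w₀.embedding 1 →* ℂˣ), (∀ σ, ((ν σ : ℂˣ) : ℂ) = ((s σ : ℤ) : ℂ)) →
    ∃ Q : (W.baseChange K).toAffine.Point,
      ((Module.finrank K (ringClassField K w₀.embedding 1) : ℝ))⁻¹ *
          (∑ τ : ringClassGal w₀.embedding 1,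
            (s τ : ℤ) • pointGalHom W₁ (ringClassField K w₀.embedding 1 : Type) τ.1 y).canonicalHeight =
        Q.canonicalHeight ∧
      ∀ (ι' : PadicAlgCl p ≃+* ℂ) (𝔭' : HeightOneSpectrum (𝓞 K)) (h𝔭' : ((p : ℕ) : 𝓞 K) ∈ 𝔭'.asIdeal)
        (he' : 𝔭'.asIdeal.ramificationIdx (𝓞 ℚ) = 1) (hf' : 𝔭'.asIdeal.inertiaDeg (𝓞 ℚ) = 1),
        (∀ (w : InfinitePlace K) (k : 𝓞 K), k ∈ 𝔭'.asIdeal ↔ ‖ι'.symm (w.embedding (k : K))‖ < 1) →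
        ∃ lam : ℂ_[p], ‖lam‖ = 1 ∧ heegnerCharLogSum ι' w₀.embedding 1 W₁ ν y =
          lam * algebraMap ℚ_[p] ℂ_[p] (logOmega W p (embAt K p 𝔭' h𝔭' he' hf') Q) := by
  intro W _ _ p _ t K _ _ hK hp2 W₁ _ _ _ C hC w₀ _ y θ hθ2 hθ0 s hθσ ν hν
  have hp : p.Prime := Fact.out
  obtain ⟨hKiq, -, ⟨-, ht, -, -⟩, -, -, hHp⟩ := hK
  have h2f : Module.finrank ℚ K = 2 := hKiq.1
  have hsplit : SplitsIn K p := hHp p hp (dvd_refl p)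
  -- the twist parameter `t ∈ {−1, 2, −2}`, a `p`-unit (no `set`: abstraction over `ℂ_p`-terms is too expensive)
  have hd₁0 : (t : ℤ) ≠ 0 := by rcases ht with rfl | rfl | rfl <;> norm_num
  have hdQ : ((t : ℤ) : ℚ) ≠ 0 := by exact_mod_cast hd₁0
  have hpd : ¬ (p : ℤ) ∣ (t : ℤ) := by
    intro h
    have h' : (p : ℤ) ∣ 2 := by
      rcases ht with rfl | rfl | rfl
      · exact (dvd_neg.mp h).trans (one_dvd _)
      · exact h
      · exact dvd_neg.mp h
    exact hp2 ((Nat.prime_dvd_prime_iff_eq hp Nat.prime_two).mp (by exact_mod_cast h'))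
  -- the reverse presentation `E = C₂ • ((D • W₁) ⊗ χ_t)`, `D • W₁` in `a₁ = a₃ = 0` form
  obtain ⟨C', hC'⟩ := SchneiderFree.exists_smul_quadraticTwist_eq_of_smul_quadraticTwist_eq W W₁ hdQ C hC
  haveI hNF : ((@WeierstrassCurve.toCharNeTwoNF ℚ _ W₁ (invertibleOfNonzero two_ne_zero)) • W₁).IsCharNeTwoNF :=
    @WeierstrassCurve.toCharNeTwoNF_spec ℚ _ W₁ (invertibleOfNonzero two_ne_zero)
  obtain ⟨C₂, hC₂⟩ := SchneiderFree.exists_charNeTwoNF_presentation W₁ W _ C' hC'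
  generalize hDdef : @WeierstrassCurve.toCharNeTwoNF ℚ _ W₁ (invertibleOfNonzero two_ne_zero) = D at hNF hC₂
  subst hC₂
  -- the descended point with its height clause
  have hθ2' : θ ^ 2 = algebraMap ℚ (ringClassField K w₀.embedding 1) ((t : ℤ) : ℚ) := by
    rw [hθ2, map_intCast]
  obtain ⟨Q, hQ, hheight, -⟩ := SchneiderFree.exists_descent_twistedHeegner w₀.embedding 1 hKiq one_ne_zero W₁ D C₂
    hθ2' hθ0 ν s hν hθσ hdQ y
  refine ⟨Q, hheight, fun ι' 𝔭' h𝔭' he' hf' hcompat ↦ ?_⟩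
  -- the two `p`-adic embeddings of `K` agree: `ι′⁻¹ ∘ w₀.embedding = embAt K p 𝔭′`
  obtain ⟨-, 𝔮, -, hne, h𝔮, -⟩ := LocalIndexTransport.exists_conj_prime_of_splitsIn K p h2f hsplit h𝔭'
  obtain ⟨he𝔮, hf𝔮⟩ := degreeOne_of_splitsIn h2f hsplit h𝔮
  have hind : ∀ k : 𝓞 K, k ∈ 𝔭'.asIdeal ↔ ‖ι'.symm (w₀.embedding (k : K))‖ < 1 := fun k ↦ hcompat w₀ k
  have heC : ∀ x, ‖(algebraMap ℚ_[p] ℂ_[p] : ℚ_[p] →+* ℂ_[p]) x‖ = ‖x‖ := fun x ↦ norm_algebraMap' ℂ_[p] x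
  have hj : ∀ x : K, ringClassFieldToPadicComplex (p := p) ι' w₀.embedding 1
        (algebraMap K (ringClassField K w₀.embedding 1) x) =
      (algebraMap ℚ_[p] ℂ_[p] : ℚ_[p] →+* ℂ_[p]) (embAt K p 𝔭' h𝔭' he' hf' x) := by
    intro x
    have e1 : ringClassFieldToPadicComplex (p := p) ι' w₀.embedding 1
        (algebraMap K (ringClassField K w₀.embedding 1) x) =
      algebraMap (PadicAlgCl p) ℂ_[p]
        (ι'.symm ((algebraMap K (ringClassField K w₀.embedding 1) x : ringClassField K w₀.embedding 1) : ℂ)) :=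
      rfl
    rw [e1, coe_algebraMap_ringClassField,
      KYRead.LogDescent.symm_apply_eq_embAt_of_forall_mem_iff_norm_lt_one h2f h𝔮 he𝔮 hf𝔮 h𝔭' he' hf' hne ι'
        w₀.embedding hind x,
      ← IsScalarTower.algebraMap_apply]
  -- the weighted logarithm sum is the logarithm of the twisted trace
  obtain ⟨-, hlog⟩ := heegnerCharLogSum_eq_padicLog_map_sum p ι' w₀.embedding 1 W₁ ν s hν y
  -- `‖Δ_E‖ = ‖Δ_{W₁}‖` in `ℂ_p`
  have hΔn : ‖((C₂ • (D • W₁).quadraticTwist ((t : ℤ) : ℚ)).baseChange ℂ_[p]).Δ‖ =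
      ‖(W₁.baseChange ℂ_[p]).Δ‖ :=
    (norm_Δ_baseChange_eq_of_twist p (algebraMap ℚ_[p] ℂ_[p] : ℚ_[p] →+* ℂ_[p]) heC hp2 hpd hd₁0
      (C₂ • (D • W₁).quadraticTwist ((t : ℤ) : ℚ)) W₁ C hC).symm
  -- the twist descent of the logarithm
  obtain ⟨hlam, hdesc⟩ := padicLog_map_eq_mul_logOmega_of_descent_of_norm_Δ_eq p W₁ D C₂
    ((t : ℤ) : ℚ) hθ2' hθ0 _ Q (by convert hQ) (embAt K p 𝔭' h𝔭' he' hf')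
    (algebraMap ℚ_[p] ℂ_[p] : ℚ_[p] →+* ℂ_[p]) heC (ringClassFieldToPadicComplex (p := p) ι' w₀.embedding 1) hj hΔn
  -- (`Eq.trans` unifies the two spellings of the `ℂ_p`-instances up to definitional equality; `rw` would not)
  exact ⟨_, hlam, hlog.trans hdesc⟩

end Transport

end Summit.BirchSwinnertonDyer.BirchSwinnertonDyer.Theorems.TwistedWanRoad

end
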